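import Mathlib
import Summits.ValiantsHypothesis.ValiantsHypothesis.Theorems.LiouvilleSarnakAlignedTypeICharactersMod2nBilinearSieveGrowthFromCharSums
import HarnessLib

/-!
# Route LiouvilleSarnak — support `AlignedTypeI` (stmt-ValiantsHypothesis-21040), line `characters_mod_2n`:
# the group `1 + 2^τ ℤ (mod 2^{n+τ})` is cyclic on `g = 1 + 2^τ` (input of Postnikov's formula)

Second brick for `HS` (see `…BilinearSieveShortCharSumsShift.lean`): Postnikov's formula
`χ(1 + 2^τ v) = e(c Λ(v)/2^{n+τ})` needs (i) the truncated `2`-adic logarithm `Λ` (a homomorphism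
`(1 + 2^τ ℤ)/(1 + 2^{n+τ}ℤ) → ℤ/2^{n+τ}`, NOT done here) and (ii) the structure of the group `1 + 2^τ ℤ (mod 2^{n+τ})`:
it is cyclic of order `2^n`, generated by `g = 1 + 2^τ` (`τ ≥ 2`).  Part (ii) is recorded here from Mathlib's
`ZMod.orderOf_one_add_mul_prime_pow`:

* `one_add_two_pow_mul_powShift` — the explicit exponents `w_d = ((1 + 2^τ)^d − 1)/2^τ` satisfy `1 + 2^τ w_d = g^d`
  (in `ℕ`, hence mod anything);
* `orderOf_one_add_two_pow` — `orderOf g = 2^n` in `ZMod (2^{n+τ})` (`τ ≥ 2`);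
* `exists_pow_eq_one_add_two_pow_mul` — ★ every `1 + 2^τ v` is `g^d (mod 2^{n+τ})` for some `d < 2^n`
  (counting: `d ↦ g^d` is injective on `d < 2^n` and lands in the `2^n` classes `1 + 2^τ v`, `v < 2^n`);
* `char_one_add_two_pow_mul_eq_pow` — hence `χ(1 + 2^τ v) = χ(g)^d`, and `χ(g)^{2^n} = 1`.

HONEST FRAMING. Helper lemmas only (unconditional); the leaf `AlignedTypeI` is NOT closed here; nothing bears on
`VP ≠ VNP` (NOT proved).
-/

set_option linter.dupNamespace false

noncomputable section

namespace Summit.ValiantsHypothesis.ValiantsHypothesis.Theorems.LiouvilleSarnak.AlignedTypeI.CharactersModTwoN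

open Finset

/-- The exponents of Gallagher–Postnikov: `w_d = ((1 + 2^τ)^d − 1)/2^τ` satisfies `1 + 2^τ w_d = (1 + 2^τ)^d`
(exact division: `2^τ ∣ (1 + 2^τ)^d − 1`). [folklore] -/
theorem one_add_two_pow_mul_powShift (τ d : ℕ) :
    1 + 2 ^ τ * (((1 + 2 ^ τ) ^ d - 1) / 2 ^ τ) = (1 + 2 ^ τ) ^ d := by
  have hdvd : 2 ^ τ ∣ (1 + 2 ^ τ) ^ d - 1 := by
    have h := Nat.sub_one_dvd_pow_sub_one (1 + 2 ^ τ) d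
    rwa [Nat.add_sub_cancel_left] at h
  rw [Nat.mul_div_cancel' hdvd]
  have : 1 ≤ (1 + 2 ^ τ) ^ d := Nat.one_le_pow _ _ (by positivity)
  omega

/-- `orderOf (1 + 2^τ) = 2^n` in `ZMod (2^{n+τ})` for `τ ≥ 2` (Mathlib's `ZMod.orderOf_one_add_mul_prime_pow`).
[folklore] -/
theorem orderOf_one_add_two_pow {τ : ℕ} (hτ : 2 ≤ τ) (n : ℕ) :
    orderOf ((1 + 2 ^ τ : ℕ) : ZMod (2 ^ (n + τ))) = 2 ^ n := by
  have h := ZMod.orderOf_one_add_mul_prime_pow Nat.prime_two τ (by omega) (by omega) (1 : ℤ)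
    (by norm_num) n
  push_cast at h ⊢
  simpa using h

/-- Reducing `v` mod `2^n` does not change `1 + 2^τ v (mod 2^{n+τ})`. [folklore] -/
theorem one_add_two_pow_mul_mod (τ n v : ℕ) :
    ((1 + 2 ^ τ * v : ℕ) : ZMod (2 ^ (n + τ))) = ((1 + 2 ^ τ * (v % 2 ^ n) : ℕ) : ZMod (2 ^ (n + τ))) := by
  rw [ZMod.natCast_eq_natCast_iff']
  have h := Nat.div_add_mod v (2 ^ n)
  have e : 1 + 2 ^ τ * v = (1 + 2 ^ τ * (v % 2 ^ n)) + 2 ^ (n + τ) * (v / 2 ^ n) := by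
    rw [pow_add]
    nth_rewrite 1 [← h]
    ring
  rw [e, Nat.add_mul_mod_self_left]

/-- ★ **`1 + 2^τ ℤ (mod 2^{n+τ})` is cyclic on `g = 1 + 2^τ`** (`τ ≥ 2`): every `1 + 2^τ v` is `g^d` for some `d < 2^n`
(and then `1 + 2^τ v ≡ 1 + 2^τ w_d`).  Counting: `d ↦ g^d`, `d < 2^n = orderOf g`, is injective and takes values among
the `2^n` classes `1 + 2^τ v'`, `v' < 2^n`. [folklore] -/
theorem exists_pow_eq_one_add_two_pow_mul {τ : ℕ} (hτ : 2 ≤ τ) (n v : ℕ) :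
    ∃ d : ℕ, d < 2 ^ n ∧
      ((1 + 2 ^ τ * v : ℕ) : ZMod (2 ^ (n + τ))) = (((1 + 2 ^ τ : ℕ) : ZMod (2 ^ (n + τ)))) ^ d := by
  classical
  set g : ZMod (2 ^ (n + τ)) := ((1 + 2 ^ τ : ℕ) : ZMod (2 ^ (n + τ))) with hg
  -- the two finite sets
  set A : Finset (ZMod (2 ^ (n + τ))) := (range (2 ^ n)).image (fun d : ℕ => g ^ d) with hA
  set B : Finset (ZMod (2 ^ (n + τ))) := (range (2 ^ n)).image (fun v' : ℕ => ((1 + 2 ^ τ * v' : ℕ) : ZMod (2 ^ (n + τ)))) with hB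
  have hord : orderOf g = 2 ^ n := by rw [hg]; exact orderOf_one_add_two_pow hτ n
  -- `A ⊆ B`
  have hAB : A ⊆ B := by
    intro x hx
    obtain ⟨d, -, rfl⟩ := mem_image.1 hx
    refine mem_image.2 ⟨(((1 + 2 ^ τ) ^ d - 1) / 2 ^ τ) % 2 ^ n, mem_range.2 (Nat.mod_lt _ (by positivity)), ?_⟩
    rw [← one_add_two_pow_mul_mod, one_add_two_pow_mul_powShift]
    push_cast
    rw [hg]; push_cast; ring
  -- `|A| = 2^n ≥ |B|`
  have hcardA : A.card = 2 ^ n := by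
    rw [hA, card_image_of_injOn, card_range]
    intro d₁ hd₁ d₂ hd₂ h
    have h1 : d₁ < orderOf g := by rw [hord]; exact mem_range.1 (mem_coe.1 hd₁)
    have h2 : d₂ < orderOf g := by rw [hord]; exact mem_range.1 (mem_coe.1 hd₂)
    exact pow_injOn_Iio_orderOf h1 h2 h
  have hcardB : B.card ≤ 2 ^ n := by
    rw [hB]; exact card_image_le.trans (card_range _).le
  have hEq : A = B := eq_of_subset_of_card_le hAB (by rw [hcardA]; exact hcardB)
  -- the class of `v` is in `B = A`
  have hv : ((1 + 2 ^ τ * v : ℕ) : ZMod (2 ^ (n + τ))) ∈ B := by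
    rw [one_add_two_pow_mul_mod]
    exact mem_image.2 ⟨v % 2 ^ n, mem_range.2 (Nat.mod_lt _ (by positivity)), rfl⟩
  rw [← hEq] at hv
  obtain ⟨d, hd, hdx⟩ := mem_image.1 hv
  exact ⟨d, mem_range.1 hd, hdx.symm⟩

/-- **Consequence for characters**: for `χ` mod `2^{n+τ}` (`τ ≥ 2`) and every `v` there is `d < 2^n` with
`χ(1 + 2^τ v) = χ(1 + 2^τ)^d`; and `χ(1 + 2^τ)^{2^n} = 1`. [folklore] -/
theorem char_one_add_two_pow_mul_eq_pow {τ : ℕ} (hτ : 2 ≤ τ) (n : ℕ) (χ : DirichletCharacter ℂ (2 ^ (n + τ)))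
    (v : ℕ) :
    (∃ d : ℕ, d < 2 ^ n ∧
      χ ((1 + 2 ^ τ * v : ℕ) : ZMod (2 ^ (n + τ))) = χ ((1 + 2 ^ τ : ℕ) : ZMod (2 ^ (n + τ))) ^ d) ∧
    χ ((1 + 2 ^ τ : ℕ) : ZMod (2 ^ (n + τ))) ^ (2 ^ n) = 1 := by
  refine ⟨?_, ?_⟩
  · obtain ⟨d, hd, h⟩ := exists_pow_eq_one_add_two_pow_mul hτ n v
    exact ⟨d, hd, by rw [h, map_pow]⟩
  · rw [← map_pow, ← orderOf_one_add_two_pow hτ n, pow_orderOf_eq_one, map_one]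

end Summit.ValiantsHypothesis.ValiantsHypothesis.Theorems.LiouvilleSarnak.AlignedTypeI.CharactersModTwoN
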